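import Literature.NumberTheory.Transcendental.LinGroupZELeibniz
import Literature.NumberTheory.Transcendental.PhilipponZeroEstimateMultiplicity
import Literature.NumberTheory.Transcendental.LinGroupZEBezout
import Literature.NumberTheory.Transcendental.PhilipponZeroEstimateIndependence
import Mathlib.Algebra.Order.Antidiag.FinsuppEquiv
import HarnessLib

/-!
# Philippon's zero estimate on `𝔾ₐ^{d₀} × 𝔾ₘ^{d₁}`: Wüstholz's multiplicity lemma (algebraic core, Step 3 and the count)

## Philippon's zero estimate on `𝔾ₐ^{d₀} × 𝔾ₘ^{d₁}`: Wüstholz's multiplicity lemma (algebraic core)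

Topic `Literature/NumberTheory/Transcendental`. Port to `LinGroup d₀ d₁` (index `Fin d₀ ⊕ Fin d₁`)
of the tree's `PhilipponZeroEstimateMultiplicity.lean` (the case `d₀ = 1`), for the zero estimate
owed to `Literature.Barriers.Schanuel.roy1992_thm1`: the algebra of D. Roy's proof of
**Prop. 3.8, Step 3** (Nesterenko–Philippon (eds.), LNM 1752, Ch. 11, pp. 217–218; Philippon 1986,
Prop. 4.7 "Wüstholz"), for the commuting invariant derivations `D_w` of `B = ℂ[X₁, …, X_{d₀}, Y₁, …, Y_{d₁}]`
(`LinGroup.invDeriv`, `LinGroup.invDeriv_comm`); the group-independent combinatorics (the order `|μ|` of a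
multi-exponent, `GaGm.order`) is reused from the `d₀ = 1` file `PhilipponZeroEstimateMultiplicity.lean`. Data: a prime `𝔭`, an ideal `𝔮 ≤ 𝔭` all of whose members are
sent into `𝔭` by the monomials `D^μ = D_{w₁}^{μ₁} ⋯ D_{w_s}^{μ_s}` of order `|μ| ≤ T`, and
`g₁, …, g_s ∈ 𝔭` with `D_{wᵢ} g_j ∈ 𝔭` for `i ≠ j` and `D_{wᵢ} gᵢ ∉ 𝔭` (Roy, Step 2). PROVED:

* `LinGroup.opPow w μ = D_{w₀}^{μ₀} ∘ ⋯ ∘ D_{w_{s-1}}^{μ_{s-1}}`: linearity, commutation with every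
  `D_e`, peeling a letter (`opPow_sub_single`), Leibniz for iterates;
* **Lemma A** (`derivation_mem_pow_pred`, `opPow_mem_pow_sub`): a derivation maps `𝔭^N` into
  `𝔭^{N-1}`, so `D^μ(𝔭^N) ⊆ 𝔭^{N-|μ|}`;
* **Lemma B** (`opPow_mul_gpow_sub_mem`): for `|κ| ≥ |μ|`,
  `D^μ(a · g^κ) ≡ [κ = μ] · (∏ μᵢ! (D_{wᵢ}gᵢ)^{μᵢ}) · a (mod 𝔭)`;
* the unit `u_μ = ∏ μᵢ! (D_{wᵢ}gᵢ)^{μᵢ} ∉ 𝔭` (`lemmaBUnit_notMem`, `lemmaBUnit_eq`).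

Step 3 itself (linear independence of the `f_l · g^κ` modulo `𝔮`, bottom-up in `|κ|`), the counting
consequence `H_𝔮(t + cT) ≥ binom(T+s, s) H_𝔭(t)` for the box filtration and the construction of the
`gᵢ` from the equations of a coset (Step 2) are in the sequels.

## Philippon's zero estimate on `𝔾ₐ^{d₀} × 𝔾ₘ^{d₁}`: Wüstholz's multiplicity lemma, Step 3 and the count

Topic `Literature/NumberTheory/Transcendental`. Port to `LinGroup d₀ d₁` (index `Fin d₀ ⊕ Fin d₁`)
of the tree's `PhilipponZeroEstimateIndependence.lean` (the case `d₀ = 1`), for the zero estimate owed to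
`Literature.Barriers.Schanuel.roy1992_thm1`, continuing `…Multiplicity.lean`
(Roy, LNM 1752, Ch. 11, Prop. 3.8 Step 3; Philippon 1986, Prop. 4.7). With the data of that file
(a prime `𝔭`, `g₁, …, g_s ∈ 𝔭` with `D_{wᵢ}g_j ∈ 𝔭 (i ≠ j)`, `D_{wᵢ}gᵢ ∉ 𝔭`, and an ideal `𝔮`
whose members are sent into `𝔭` by all `D^μ`, `|μ| ≤ T`) we PROVE:

* **`coeff_eq_zero_of_sum_mem`** (Step 3): if `(F_l)` are linearly independent modulo `𝔭`, a
  `ℂ`-combination of the products `F_l · g^κ` (`κ` in a finite set of multi-indices of order `≤ T`)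
  lying in `𝔮` has all its coefficients zero (induction on `|κ|`, applying `D^μ` and Lemma B);
* **`choose_mul_hilbI_le`** (the count, for the box filtration of `LinGroupZEZariski.lean` /
  `LinGroupZEBezout.lean`): if moreover `gᵢ ∈ Box(c)`, then for every `t`,
  `binom(T+s, s) · H_𝔭(t) ≤ H_𝔮(t + cT)` where `H_N(t) = dim Box(t) - dim(Box(t) ∩ N)`
  (`LinGroup.hilbI`) — Roy's (95) `H(𝔮; D + dT) ≥ binom(T+s,s) H(𝔭; D)`.

The group-independent combinatorics (`GaGm.indexSet s T`, the multi-indices of order `≤ T`, with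
`order_le_of_mem_indexSet` and the stars-and-bars count `card_indexSet`) is reused from the
`d₀ = 1` file `PhilipponZeroEstimateIndependence.lean`.

## References

* Yu. V. Nesterenko, P. Philippon (eds.), *Introduction to Algebraic Independence Theory*,
  LNM 1752, Springer 2001, Ch. 11 (D. Roy), Prop. 3.8, Steps 2–3 (pp. 216–218).
* P. Philippon, *Lemmes de zéros dans les groupes algébriques commutatifs*, Bull. Soc. Math.
  France 114 (1986), 355–383, Lemme 4.6, Prop. 4.7.
  LNM 1752, Springer 2001, Ch. 11 (D. Roy), Prop. 3.8, Step 3, (95)–(97) (pp. 217–218).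
  France 114 (1986), 355–383, Prop. 4.7.
-/
noncomputable section

open MvPolynomial

namespace Literature.NumberTheory.Transcendental

namespace LinGroup

open GaGm (order)

variable {d₀ d₁ : ℕ}

/-! ### Monomials in commuting derivations -/

/-- `D^μ = D_{w₀}^{μ₀} ∘ D_{w₁}^{μ₁} ∘ ⋯ ∘ D_{w_{s-1}}^{μ_{s-1}}` applied to `f`. [folklore] -/
def opPow : {s : ℕ} → (Fin s → (Fin d₀ → ℂ) × (Fin d₁ → ℂ)) → (Fin s → ℕ) → MvPolynomial (Fin d₀ ⊕ Fin d₁) ℂ →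
    MvPolynomial (Fin d₀ ⊕ Fin d₁) ℂ
  | 0, _, _, f => f
  | _ + 1, w, μ, f => (invDeriv (w 0))^[μ 0] (opPow (Fin.tail w) (Fin.tail μ) f)

/-- `D^μ` for `s = 0` is the identity. [folklore] -/
@[simp] theorem opPow_zero (w : Fin 0 → (Fin d₀ → ℂ) × (Fin d₁ → ℂ)) (μ : Fin 0 → ℕ)
    (f : MvPolynomial (Fin d₀ ⊕ Fin d₁) ℂ) : opPow w μ f = f := rfl

/-- Recursion of `D^μ`. [folklore] -/
theorem opPow_succ {s : ℕ} (w : Fin (s + 1) → (Fin d₀ → ℂ) × (Fin d₁ → ℂ)) (μ : Fin (s + 1) → ℕ)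
    (f : MvPolynomial (Fin d₀ ⊕ Fin d₁) ℂ) :
    opPow w μ f = (invDeriv (w 0))^[μ 0] (opPow (Fin.tail w) (Fin.tail μ) f) := rfl

/-- Iterates of `D_a` commute with `D_e`. [folklore] -/
theorem iterate_invDeriv_comm (a e : (Fin d₀ → ℂ) × (Fin d₁ → ℂ)) (k : ℕ) (f : MvPolynomial (Fin d₀ ⊕ Fin d₁) ℂ) :
    (invDeriv a)^[k] (invDeriv e f) = invDeriv e ((invDeriv a)^[k] f) := by
  induction k generalizing f with
  | zero => rfl
  | succ k ih => rw [Function.iterate_succ_apply, Function.iterate_succ_apply, ← invDeriv_comm, ih]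

/-- `D^μ` commutes with every `D_e`. [folklore] -/
theorem opPow_invDeriv_comm {s : ℕ} (w : Fin s → (Fin d₀ → ℂ) × (Fin d₁ → ℂ)) (μ : Fin s → ℕ)
    (e : (Fin d₀ → ℂ) × (Fin d₁ → ℂ)) (f : MvPolynomial (Fin d₀ ⊕ Fin d₁) ℂ) :
    opPow w μ (invDeriv e f) = invDeriv e (opPow w μ f) := by
  induction s generalizing f with
  | zero => rfl
  | succ s ih => rw [opPow_succ, opPow_succ, ih, iterate_invDeriv_comm]

/-- `D^μ` is additive. [folklore] -/
theorem opPow_add {s : ℕ} (w : Fin s → (Fin d₀ → ℂ) × (Fin d₁ → ℂ)) (μ : Fin s → ℕ)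
    (f g : MvPolynomial (Fin d₀ ⊕ Fin d₁) ℂ) : opPow w μ (f + g) = opPow w μ f + opPow w μ g := by
  induction s generalizing f g with
  | zero => rfl
  | succ s ih => rw [opPow_succ, opPow_succ, opPow_succ, ih, invDeriv_iterate_add]

/-- `D^μ` is `ℂ`-homogeneous. [folklore] -/
theorem opPow_smul {s : ℕ} (w : Fin s → (Fin d₀ → ℂ) × (Fin d₁ → ℂ)) (μ : Fin s → ℕ) (c : ℂ)
    (f : MvPolynomial (Fin d₀ ⊕ Fin d₁) ℂ) : opPow w μ (c • f) = c • opPow w μ f := by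
  induction s generalizing f with
  | zero => rfl
  | succ s ih => rw [opPow_succ, opPow_succ, ih, invDeriv_iterate_smul]

/-- `D^0 = id`. [folklore] -/
theorem opPow_zero_exponent {s : ℕ} (w : Fin s → (Fin d₀ → ℂ) × (Fin d₁ → ℂ)) (f : MvPolynomial (Fin d₀ ⊕ Fin d₁) ℂ) :
    opPow w 0 f = f := by
  induction s generalizing f with
  | zero => rfl
  | succ s ih => rw [opPow_succ]; exact ih _ f

/-- `D^μ` of a finite sum. [folklore] -/
theorem opPow_sum {s : ℕ} (w : Fin s → (Fin d₀ → ℂ) × (Fin d₁ → ℂ)) (μ : Fin s → ℕ) {ι : Type*}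
    (t : Finset ι) (f : ι → MvPolynomial (Fin d₀ ⊕ Fin d₁) ℂ) :
    opPow w μ (∑ i ∈ t, f i) = ∑ i ∈ t, opPow w μ (f i) := by
  classical
  induction t using Finset.induction_on with
  | empty =>
    simp only [Finset.sum_empty]
    have := opPow_smul w μ 0 (0 : MvPolynomial (Fin d₀ ⊕ Fin d₁) ℂ)
    simpa using this
  | insert a t ha ih => rw [Finset.sum_insert ha, Finset.sum_insert ha, opPow_add, ih]

/-- **Peeling a letter**: if `μᵢ > 0` then `D^μ f = D^{μ - eᵢ}(D_{wᵢ} f)`. [folklore] -/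
theorem opPow_sub_single {s : ℕ} (w : Fin s → (Fin d₀ → ℂ) × (Fin d₁ → ℂ)) (μ : Fin s → ℕ) (i : Fin s)
    (hi : 0 < μ i) (f : MvPolynomial (Fin d₀ ⊕ Fin d₁) ℂ) :
    opPow w μ f = opPow w (μ - Pi.single i 1) (invDeriv (w i) f) := by
  induction s generalizing f with
  | zero => exact i.elim0
  | succ s ih =>
    refine Fin.cases ?_ (fun i' => ?_) i hi
    · intro h0
      rw [opPow_succ, opPow_succ, opPow_invDeriv_comm]
      have htail : Fin.tail (μ - Pi.single (0 : Fin (s + 1)) 1) = Fin.tail μ := by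
        funext j; simp [Fin.tail, Fin.succ_ne_zero]
      have hzero : (μ - Pi.single (0 : Fin (s + 1)) 1 : Fin (s + 1) → ℕ) 0 = μ 0 - 1 := by simp
      rw [htail, hzero, ← Function.iterate_succ_apply]
      congr 1
      omega
    · intro h'
      rw [opPow_succ, opPow_succ, ih (Fin.tail w) (Fin.tail μ) i' h']
      have htail : Fin.tail (μ - Pi.single i'.succ 1) = Fin.tail μ - Pi.single i' 1 := by
        funext j
        simp only [Fin.tail, Pi.sub_apply, Pi.single_apply, Fin.succ_inj]
      have h0 : (μ - Pi.single i'.succ 1 : Fin (s + 1) → ℕ) 0 = μ 0 := by simp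
      rw [htail, h0]
      rfl

/-! ### Lemma A: derivations and powers of an ideal -/

/-- **Lemma A**: a derivation maps `𝔭^{N+1}` into `𝔭^N`. [folklore] -/
theorem derivation_mem_pow_pred (D : Derivation ℂ (MvPolynomial (Fin d₀ ⊕ Fin d₁) ℂ) (MvPolynomial (Fin d₀ ⊕ Fin d₁) ℂ))
    (𝔭 : Ideal (MvPolynomial (Fin d₀ ⊕ Fin d₁) ℂ)) :
    ∀ (N : ℕ) {f : MvPolynomial (Fin d₀ ⊕ Fin d₁) ℂ}, f ∈ 𝔭 ^ (N + 1) → D f ∈ 𝔭 ^ N := by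
  intro N
  induction N with
  | zero => intro f _; simp
  | succ N ih =>
    intro f hf
    rw [pow_succ'] at hf
    refine Submodule.mul_induction_on hf (fun a ha b hb => ?_) (fun x y hx hy => ?_)
    · -- `a ∈ 𝔭`, `b ∈ 𝔭^{N+1}`: `D(ab) = a Db + b Da`
      rw [Derivation.leibniz, smul_eq_mul, smul_eq_mul, pow_succ']
      refine Ideal.add_mem _ (Ideal.mul_mem_mul ha (ih hb)) ?_
      have hb' : b ∈ 𝔭 * 𝔭 ^ N := by rw [← pow_succ']; exact hb
      exact Ideal.mul_mem_right _ _ hb' 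
    · rw [map_add]
      exact Ideal.add_mem _ hx hy

/-- Iterates: `D^k(𝔭^{N}) ⊆ 𝔭^{N-k}`. [folklore] -/
theorem iterate_derivation_mem_pow_sub (D : Derivation ℂ (MvPolynomial (Fin d₀ ⊕ Fin d₁) ℂ) (MvPolynomial (Fin d₀ ⊕ Fin d₁) ℂ))
    (𝔭 : Ideal (MvPolynomial (Fin d₀ ⊕ Fin d₁) ℂ)) (k : ℕ) :
    ∀ {N : ℕ} {f : MvPolynomial (Fin d₀ ⊕ Fin d₁) ℂ}, f ∈ 𝔭 ^ N → D^[k] f ∈ 𝔭 ^ (N - k) := by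
  induction k with
  | zero => intro N f hf; simpa using hf
  | succ k ih =>
    intro N f hf
    rw [Function.iterate_succ_apply']
    have h := ih hf
    rcases Nat.lt_or_ge k N with hlt | hge
    · obtain ⟨M, hM⟩ : ∃ M, N - k = M + 1 := ⟨N - k - 1, by omega⟩
      rw [hM] at h
      rw [show N - (k + 1) = M by omega]
      exact derivation_mem_pow_pred D 𝔭 M h
    · rw [show N - (k + 1) = 0 by omega, pow_zero, Ideal.one_eq_top]
      trivial

/-- **Lemma A for `D^μ`**: `D^μ(𝔭^N) ⊆ 𝔭^{N - |μ|}`. [folklore] -/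
theorem opPow_mem_pow_sub {s : ℕ} (w : Fin s → (Fin d₀ → ℂ) × (Fin d₁ → ℂ)) (𝔭 : Ideal (MvPolynomial (Fin d₀ ⊕ Fin d₁) ℂ)) :
    ∀ (μ : Fin s → ℕ) {N : ℕ} {f : MvPolynomial (Fin d₀ ⊕ Fin d₁) ℂ}, f ∈ 𝔭 ^ N →
      opPow w μ f ∈ 𝔭 ^ (N - order μ) := by
  induction s with
  | zero => intro μ N f hf; simpa [order] using hf
  | succ s ih =>
    intro μ N f hf
    rw [opPow_succ]
    have h := ih (Fin.tail w) (Fin.tail μ) hf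
    have h2 := iterate_derivation_mem_pow_sub (invDeriv (w 0)) 𝔭 (μ 0) h
    have hord : order μ = μ 0 + order (Fin.tail μ) := by
      simp only [order, Fin.sum_univ_succ]; rfl
    rwa [hord, show N - (μ 0 + order (Fin.tail μ)) = N - order (Fin.tail μ) - μ 0 by omega]

/-- In particular `D^μ f ∈ 𝔭` for `f ∈ 𝔭^N` and `|μ| < N`. [folklore] -/
theorem opPow_mem_of_mem_pow {s : ℕ} (w : Fin s → (Fin d₀ → ℂ) × (Fin d₁ → ℂ)) {𝔭 : Ideal (MvPolynomial (Fin d₀ ⊕ Fin d₁) ℂ)}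
    (μ : Fin s → ℕ) {N : ℕ} {f : MvPolynomial (Fin d₀ ⊕ Fin d₁) ℂ} (hf : f ∈ 𝔭 ^ N) (hN : order μ < N) :
    opPow w μ f ∈ 𝔭 := by
  have h := opPow_mem_pow_sub w 𝔭 μ hf
  obtain ⟨M, hM⟩ : ∃ M, N - order μ = M + 1 := ⟨N - order μ - 1, by omega⟩
  rw [hM, pow_succ] at h
  exact Ideal.mul_le_left h

/-! ### Lemma B: `D^μ (a · g^κ)` modulo `𝔭` -/

/-- The power products `g^κ = ∏ gᵢ^{κᵢ}`. [folklore] -/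
def gpow {s : ℕ} (g : Fin s → MvPolynomial (Fin d₀ ⊕ Fin d₁) ℂ) (κ : Fin s → ℕ) : MvPolynomial (Fin d₀ ⊕ Fin d₁) ℂ :=
  ∏ i, g i ^ κ i

/-- `g^κ ∈ 𝔭^{|κ|}` when all `gᵢ ∈ 𝔭`. [folklore] -/
theorem gpow_mem_pow {s : ℕ} {g : Fin s → MvPolynomial (Fin d₀ ⊕ Fin d₁) ℂ} {𝔭 : Ideal (MvPolynomial (Fin d₀ ⊕ Fin d₁) ℂ)}
    (hg : ∀ i, g i ∈ 𝔭) (κ : Fin s → ℕ) : gpow g κ ∈ 𝔭 ^ order κ := by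
  classical
  unfold gpow order
  have key : ∀ t : Finset (Fin s), ∏ i ∈ t, g i ^ κ i ∈ 𝔭 ^ ∑ i ∈ t, κ i := by
    intro t
    induction t using Finset.induction_on with
    | empty => simp
    | insert a t ha ih =>
      rw [Finset.prod_insert ha, Finset.sum_insert ha, pow_add]
      exact Ideal.mul_mem_mul (Ideal.pow_mem_pow (hg a) _) ih
  exact key Finset.univ

/-- The unit `u_μ = ∏ μᵢ! (D_{wᵢ} gᵢ)^{μᵢ}` of Lemma B. [folklore] -/
def lemmaBUnit {s : ℕ} (w : Fin s → (Fin d₀ → ℂ) × (Fin d₁ → ℂ)) (g : Fin s → MvPolynomial (Fin d₀ ⊕ Fin d₁) ℂ)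
    (μ : Fin s → ℕ) : MvPolynomial (Fin d₀ ⊕ Fin d₁) ℂ :=
  ∏ i, (C ((μ i).factorial : ℂ) * invDeriv (w i) (g i) ^ μ i)

/-- `u_μ ∉ 𝔭` when the `D_{wᵢ} gᵢ ∉ 𝔭`. [folklore] -/
theorem lemmaBUnit_notMem {s : ℕ} (w : Fin s → (Fin d₀ → ℂ) × (Fin d₁ → ℂ)) {g : Fin s → MvPolynomial (Fin d₀ ⊕ Fin d₁) ℂ}
    {𝔭 : Ideal (MvPolynomial (Fin d₀ ⊕ Fin d₁) ℂ)} (h𝔭 : 𝔭.IsPrime) (hdiag : ∀ i, invDeriv (w i) (g i) ∉ 𝔭)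
    (μ : Fin s → ℕ) : lemmaBUnit w g μ ∉ 𝔭 := by
  classical
  unfold lemmaBUnit
  refine (h𝔭.prod_mem_iff (s := Finset.univ)).not.mpr ?_
  push Not
  intro i _ h
  rcases h𝔭.mem_or_mem h with h1 | h1
  · have hu : IsUnit (C ((μ i).factorial : ℂ) : MvPolynomial (Fin d₀ ⊕ Fin d₁) ℂ) :=
      (isUnit_iff_ne_zero.mpr (by exact_mod_cast (μ i).factorial_ne_zero)).map C
    exact h𝔭.ne_top (Ideal.eq_top_of_isUnit_mem _ h1 hu)
  · exact hdiag i (h𝔭.mem_of_pow_mem _ h1)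

/-- `∏_{j∈J} g_j^{κ_j} ∈ 𝔭^{∑_J κ_j}` when all `g_j ∈ 𝔭`, in any commutative semiring (generic
form of the `d₀ = 1` lemma `GaGm.prod_pow_mem_pow_sum`). [folklore] -/
theorem prod_pow_mem_pow_sum' {R : Type*} [CommSemiring R] {ι : Type*} {𝔭 : Ideal R} {g : ι → R}
    (hg : ∀ j, g j ∈ 𝔭) (J : Finset ι) (κ : ι → ℕ) :
    ∏ j ∈ J, g j ^ κ j ∈ 𝔭 ^ ∑ j ∈ J, κ j := by
  classical
  induction J using Finset.induction_on with
  | empty => simp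
  | insert a J ha ih =>
    rw [Finset.prod_insert ha, Finset.sum_insert ha, pow_add]
    exact Ideal.mul_mem_mul (Ideal.pow_mem_pow (hg a) _) ih

section LemmaB

variable {s : ℕ} {w : Fin s → (Fin d₀ → ℂ) × (Fin d₁ → ℂ)} {g : Fin s → MvPolynomial (Fin d₀ ⊕ Fin d₁) ℂ}
  {𝔭 : Ideal (MvPolynomial (Fin d₀ ⊕ Fin d₁) ℂ)}

/-- **Lemma A'**: a derivation sending each `g_j`, `j ∈ J`, into `𝔭` sends `∏_{j ∈ J} g_j^{κ_j}`
into `𝔭^{∑_J κ_j}` (no loss of one power). [folklore] -/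
theorem derivation_prod_pow_mem (D : Derivation ℂ (MvPolynomial (Fin d₀ ⊕ Fin d₁) ℂ) (MvPolynomial (Fin d₀ ⊕ Fin d₁) ℂ))
    (hg : ∀ j, g j ∈ 𝔭) (J : Finset (Fin s)) (hD : ∀ j ∈ J, D (g j) ∈ 𝔭) (κ : Fin s → ℕ) :
    D (∏ j ∈ J, g j ^ κ j) ∈ 𝔭 ^ ∑ j ∈ J, κ j := by
  classical
  induction J using Finset.induction_on with
  | empty => simp
  | insert a J ha ih =>
    rw [Finset.prod_insert ha, Finset.sum_insert ha, Derivation.leibniz, smul_eq_mul, smul_eq_mul,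
      pow_add]
    have hD' : ∀ j ∈ J, D (g j) ∈ 𝔭 := fun j hj => hD j (Finset.mem_insert_of_mem hj)
    refine Ideal.add_mem _ (Ideal.mul_mem_mul (Ideal.pow_mem_pow (hg a) _) (ih hD')) ?_
    -- `(∏_J) · D(g_a^{κ_a})` with `D(g_a^k) = k g_a^{k-1} D g_a ∈ 𝔭^k`
    rw [mul_comm (∏ j ∈ J, g j ^ κ j) (D (g a ^ κ a))]
    refine Ideal.mul_mem_mul ?_ (prod_pow_mem_pow_sum' hg J κ)
    rw [Derivation.leibniz_pow]
    rcases Nat.eq_zero_or_pos (κ a) with h0 | hpos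
    · simp [h0]
    · rw [nsmul_eq_mul, smul_eq_mul]
      refine Ideal.mul_mem_left _ _ ?_
      have : g a ^ (κ a - 1) * D (g a) ∈ 𝔭 ^ (κ a - 1 + 1) := by
        rw [pow_succ]
        exact Ideal.mul_mem_mul (Ideal.pow_mem_pow (hg a) _) (hD a (Finset.mem_insert_self a J))
      rwa [Nat.sub_add_cancel hpos] at this

/-- Splitting off the `i`-th factor of `g^κ`. [folklore] -/
theorem gpow_eq_mul_prod_erase (g : Fin s → MvPolynomial (Fin d₀ ⊕ Fin d₁) ℂ) (κ : Fin s → ℕ) (i : Fin s) :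
    gpow g κ = g i ^ κ i * ∏ j ∈ Finset.univ.erase i, g j ^ κ j := by
  classical
  rw [gpow, ← Finset.mul_prod_erase Finset.univ (fun j => g j ^ κ j) (Finset.mem_univ i)]

/-- `g^{κ - eᵢ}` in split form (for `κᵢ ≥ 1`). [folklore] -/
theorem gpow_sub_single (g : Fin s → MvPolynomial (Fin d₀ ⊕ Fin d₁) ℂ) (κ : Fin s → ℕ) (i : Fin s) :
    gpow g (κ - Pi.single i 1) = g i ^ (κ i - 1) * ∏ j ∈ Finset.univ.erase i, g j ^ κ j := by
  classical
  rw [gpow_eq_mul_prod_erase _ _ i, Pi.sub_apply, Pi.single_eq_same]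
  congr 1
  refine Finset.prod_congr rfl fun j hj => ?_
  rw [Pi.sub_apply, Pi.single_apply, if_neg (Finset.ne_of_mem_erase hj), Nat.sub_zero]

/-- The derivative of `g^κ` in the direction `wᵢ` modulo `𝔭^{|κ|}`:
`D_{wᵢ}(g^κ) - κᵢ (D_{wᵢ}gᵢ) g^{κ - eᵢ} ∈ 𝔭^{|κ|}` (the factors `j ≠ i` pick up `D_{wᵢ}g_j ∈ 𝔭`).
[folklore] -/
theorem invDeriv_gpow_sub_mem (hg : ∀ i, g i ∈ 𝔭) (hoff : ∀ i j, i ≠ j → invDeriv (w i) (g j) ∈ 𝔭)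
    (i : Fin s) (κ : Fin s → ℕ) :
    invDeriv (w i) (gpow g κ) - C (κ i : ℂ) * invDeriv (w i) (g i) * gpow g (κ - Pi.single i 1) ∈
      𝔭 ^ order κ := by
  classical
  rw [gpow_eq_mul_prod_erase g κ i, gpow_sub_single, Derivation.leibniz, smul_eq_mul, smul_eq_mul,
    Derivation.leibniz_pow, nsmul_eq_mul, smul_eq_mul]
  have hord : order κ = κ i + ∑ j ∈ Finset.univ.erase i, κ j := by
    rw [order, ← Finset.add_sum_erase Finset.univ κ (Finset.mem_univ i)]
  -- the `D(rest)` term lies in `𝔭^{|κ|}`; the other two terms cancel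
  have hrest : g i ^ κ i * invDeriv (w i) (∏ j ∈ Finset.univ.erase i, g j ^ κ j) ∈ 𝔭 ^ order κ := by
    rw [hord, pow_add]
    exact Ideal.mul_mem_mul (Ideal.pow_mem_pow (hg i) _)
      (derivation_prod_pow_mem (invDeriv (w i)) hg _ (fun j hj => hoff i j (Finset.ne_of_mem_erase hj).symm) κ)
  have e : g i ^ κ i * invDeriv (w i) (∏ j ∈ Finset.univ.erase i, g j ^ κ j) +
      (∏ j ∈ Finset.univ.erase i, g j ^ κ j) * ((κ i : MvPolynomial (Fin d₀ ⊕ Fin d₁) ℂ) * (g i ^ (κ i - 1) * invDeriv (w i) (g i))) -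
      C (κ i : ℂ) * invDeriv (w i) (g i) * (g i ^ (κ i - 1) * ∏ j ∈ Finset.univ.erase i, g j ^ κ j) =
      g i ^ κ i * invDeriv (w i) (∏ j ∈ Finset.univ.erase i, g j ^ κ j) := by
    rw [← map_natCast C]
    ring
  rw [e]
  exact hrest

/-- Peeling the `i`-th factor of the unit: `u_μ = μᵢ (D_{wᵢ}gᵢ) u_{μ - eᵢ}` for `μᵢ ≥ 1`. [folklore] -/
theorem lemmaBUnit_eq (w : Fin s → (Fin d₀ → ℂ) × (Fin d₁ → ℂ)) (g : Fin s → MvPolynomial (Fin d₀ ⊕ Fin d₁) ℂ)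
    {μ : Fin s → ℕ} {i : Fin s} (hi : 1 ≤ μ i) :
    lemmaBUnit w g μ = C (μ i : ℂ) * invDeriv (w i) (g i) * lemmaBUnit w g (μ - Pi.single i 1) := by
  classical
  have split : ∀ ν : Fin s → ℕ, lemmaBUnit w g ν =
      (C ((ν i).factorial : ℂ) * invDeriv (w i) (g i) ^ ν i) *
        ∏ j ∈ Finset.univ.erase i, (C ((ν j).factorial : ℂ) * invDeriv (w j) (g j) ^ ν j) := fun ν => by
    unfold lemmaBUnit
    rw [Finset.mul_prod_erase Finset.univ (fun j => C ((ν j).factorial : ℂ) * invDeriv (w j) (g j) ^ ν j)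
      (Finset.mem_univ i)]
  rw [split μ, split (μ - Pi.single i 1)]
  have hj : ∀ j ∈ Finset.univ.erase i, (μ - Pi.single i 1 : Fin s → ℕ) j = μ j := fun j hj => by
    rw [Pi.sub_apply, Pi.single_apply, if_neg (Finset.ne_of_mem_erase hj), Nat.sub_zero]
  have hprod : ∏ j ∈ Finset.univ.erase i, (C (((μ - Pi.single i 1 : Fin s → ℕ) j).factorial : ℂ) *
      invDeriv (w j) (g j) ^ (μ - Pi.single i 1 : Fin s → ℕ) j) =
      ∏ j ∈ Finset.univ.erase i, (C ((μ j).factorial : ℂ) * invDeriv (w j) (g j) ^ μ j) :=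
    Finset.prod_congr rfl fun j hj' => by rw [hj j hj']
  rw [hprod]
  have hii : (μ - Pi.single i 1 : Fin s → ℕ) i = μ i - 1 := by rw [Pi.sub_apply, Pi.single_eq_same]
  rw [hii]
  obtain ⟨k, hk⟩ : ∃ k, μ i = k + 1 := ⟨μ i - 1, by omega⟩
  rw [hk, Nat.add_sub_cancel, Nat.factorial_succ, Nat.cast_mul, map_mul, pow_succ]
  push_cast
  ring

/-- **Lemma B**: for `|κ| ≥ |μ|`, `D^μ(a g^κ) ≡ [κ = μ] u_μ a (mod 𝔭)`.
[cite: NesterenkoPhilippon2001, Ch. 11 Prop. 3.8 (Step 3)] -/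
theorem opPow_mul_gpow_sub_mem (hg : ∀ i, g i ∈ 𝔭) (hoff : ∀ i j, i ≠ j → invDeriv (w i) (g j) ∈ 𝔭) :
    ∀ (m : ℕ) (μ : Fin s → ℕ), order μ = m → ∀ (a : MvPolynomial (Fin d₀ ⊕ Fin d₁) ℂ) (κ : Fin s → ℕ),
      m ≤ order κ → opPow w μ (a * gpow g κ) - (if κ = μ then lemmaBUnit w g μ * a else 0) ∈ 𝔭 := by
  classical
  intro m
  induction m with
  | zero =>
    intro μ hμ a κ _
    have hμ0 : μ = 0 := by
      funext i
      have := (Finset.sum_eq_zero_iff.mp hμ) i (Finset.mem_univ i)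
      simpa using this
    subst hμ0
    rw [opPow_zero_exponent]
    by_cases hκ : κ = 0
    · subst hκ
      simp [gpow, lemmaBUnit]
    · rw [if_neg hκ, sub_zero]
      have hpos : 0 < order κ := by
        by_contra h
        apply hκ
        funext i
        have := (Finset.sum_eq_zero_iff.mp (Nat.le_zero.mp (not_lt.mp h))) i (Finset.mem_univ i)
        simpa using this
      have h := gpow_mem_pow (𝔭 := 𝔭) hg κ
      obtain ⟨M, hM⟩ : ∃ M, order κ = M + 1 := ⟨order κ - 1, by omega⟩
      rw [hM, pow_succ] at h
      exact Ideal.mul_mem_left _ a (Ideal.mul_le_left h)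
  | succ m ih =>
    intro μ hμ a κ hκ
    -- a letter to peel
    obtain ⟨i, hi⟩ : ∃ i, 0 < μ i := by
      by_contra h
      push Not at h
      have : order μ = 0 := Finset.sum_eq_zero fun i _ => Nat.le_zero.mp (h i)
      omega
    set μ' := μ - Pi.single i 1 with hμ'
    have hμ'ord : order μ' = m := by
      have h1 : order μ = μ i + ∑ j ∈ Finset.univ.erase i, μ j := by
        rw [order, ← Finset.add_sum_erase Finset.univ μ (Finset.mem_univ i)]
      have h2 : order μ' = μ' i + ∑ j ∈ Finset.univ.erase i, μ' j := by
        rw [order, ← Finset.add_sum_erase Finset.univ μ' (Finset.mem_univ i)]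
      have h3 : ∑ j ∈ Finset.univ.erase i, μ' j = ∑ j ∈ Finset.univ.erase i, μ j :=
        Finset.sum_congr rfl fun j hj => by
          rw [hμ', Pi.sub_apply, Pi.single_apply, if_neg (Finset.ne_of_mem_erase hj), Nat.sub_zero]
      have h4 : μ' i = μ i - 1 := by rw [hμ', Pi.sub_apply, Pi.single_eq_same]
      omega
    rw [opPow_sub_single w μ i hi, Derivation.leibniz, smul_eq_mul, smul_eq_mul]
    -- `D_i (g^κ) = κ_i h_i g^{κ - e_i} + E`
    set E := invDeriv (w i) (gpow g κ) - C (κ i : ℂ) * invDeriv (w i) (g i) * gpow g (κ - Pi.single i 1)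
      with hE
    have hEmem : E ∈ 𝔭 ^ order κ := invDeriv_gpow_sub_mem hg hoff i κ
    have hsplit : a * invDeriv (w i) (gpow g κ) + gpow g κ * invDeriv (w i) a =
        invDeriv (w i) a * gpow g κ + a * E +
          (C (κ i : ℂ) * invDeriv (w i) (g i) * a) * gpow g (κ - Pi.single i 1) := by
      rw [hE]; ring
    rw [hsplit, opPow_add, opPow_add]
    -- term (1): strictly bigger order ⇒ in `𝔭`
    have h1 : opPow w μ' (invDeriv (w i) a * gpow g κ) ∈ 𝔭 := by
      have h := ih μ' hμ'ord (invDeriv (w i) a) κ (by omega)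
      rwa [if_neg (by rintro rfl; omega), sub_zero] at h
    -- term (2): `a E ∈ 𝔭^{|κ|}`, `|μ'| = m < |κ|`
    have h2 : opPow w μ' (a * E) ∈ 𝔭 :=
      opPow_mem_of_mem_pow w μ' (Ideal.mul_mem_left _ a hEmem) (by omega)
    -- term (3)
    have h3 : opPow w μ' ((C (κ i : ℂ) * invDeriv (w i) (g i) * a) * gpow g (κ - Pi.single i 1)) -
        (if κ = μ then lemmaBUnit w g μ * a else 0) ∈ 𝔭 := by
      rcases Nat.eq_zero_or_pos (κ i) with hκ0 | hκpos
      · have hne : κ ≠ μ := by rintro rfl; omega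
        rw [if_neg hne, hκ0, Nat.cast_zero, map_zero, zero_mul, zero_mul, zero_mul, sub_zero]
        have := opPow_smul w μ' 0 (0 : MvPolynomial (Fin d₀ ⊕ Fin d₁) ℂ)
        simp only [zero_smul] at this
        rw [this]; exact Ideal.zero_mem _
      · have hord' : m ≤ order (κ - Pi.single i 1) := by
          have e1 : order (κ - Pi.single i 1) + 1 = order κ := by
            have h1 : order κ = κ i + ∑ j ∈ Finset.univ.erase i, κ j := by
              rw [order, ← Finset.add_sum_erase Finset.univ κ (Finset.mem_univ i)]
            have h2 : order (κ - Pi.single i 1) = (κ - Pi.single i 1 : Fin s → ℕ) i +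
                ∑ j ∈ Finset.univ.erase i, (κ - Pi.single i 1 : Fin s → ℕ) j := by
              rw [order, ← Finset.add_sum_erase Finset.univ (κ - Pi.single i 1) (Finset.mem_univ i)]
            have h3 : ∑ j ∈ Finset.univ.erase i, (κ - Pi.single i 1 : Fin s → ℕ) j =
                ∑ j ∈ Finset.univ.erase i, κ j :=
              Finset.sum_congr rfl fun j hj => by
                rw [Pi.sub_apply, Pi.single_apply, if_neg (Finset.ne_of_mem_erase hj), Nat.sub_zero]
            have h4 : (κ - Pi.single i 1 : Fin s → ℕ) i = κ i - 1 := by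
              rw [Pi.sub_apply, Pi.single_eq_same]
            omega
          omega
        have h := ih μ' hμ'ord (C (κ i : ℂ) * invDeriv (w i) (g i) * a) (κ - Pi.single i 1) hord'
        have hiff : (κ - Pi.single i 1 = μ') ↔ (κ = μ) := by
          constructor
          · intro heq
            funext j
            have hj := congrFun heq j
            by_cases hji : j = i
            · subst hji
              rw [Pi.sub_apply, Pi.single_eq_same, hμ', Pi.sub_apply, Pi.single_eq_same] at hj
              omega
            · rwa [Pi.sub_apply, Pi.single_apply, if_neg hji, hμ', Pi.sub_apply, Pi.single_apply,
                if_neg hji, Nat.sub_zero, Nat.sub_zero] at hj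
          · rintro rfl; rfl
        by_cases hκμ : κ = μ
        · rw [if_pos hκμ]
          rw [if_pos (hiff.mpr hκμ)] at h
          have hu : lemmaBUnit w g μ' * (C (κ i : ℂ) * invDeriv (w i) (g i) * a) = lemmaBUnit w g μ * a := by
            rw [hκμ, lemmaBUnit_eq w g (i := i) hi, hμ']; ring
          rwa [hu] at h
        · rw [if_neg hκμ]
          rwa [if_neg (fun h' => hκμ (hiff.mp h'))] at h
    have e : opPow w μ' (invDeriv (w i) a * gpow g κ) + opPow w μ' (a * E) +
        opPow w μ' (C (κ i : ℂ) * invDeriv (w i) (g i) * a * gpow g (κ - Pi.single i 1)) -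
        (if κ = μ then lemmaBUnit w g μ * a else 0) =
        opPow w μ' (invDeriv (w i) a * gpow g κ) + opPow w μ' (a * E) +
        (opPow w μ' (C (κ i : ℂ) * invDeriv (w i) (g i) * a * gpow g (κ - Pi.single i 1)) -
          (if κ = μ then lemmaBUnit w g μ * a else 0)) := by ring
    rw [e]
    exact Ideal.add_mem _ (Ideal.add_mem _ h1 h2) h3

end LemmaB

end LinGroup

end Literature.NumberTheory.Transcendental

noncomputable section

open MvPolynomial Module

namespace Literature.NumberTheory.Transcendental

namespace LinGroup

open GaGm (order indexSet order_le_of_mem_indexSet card_indexSet)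

variable {d₀ d₁ : ℕ}

section Step3

variable {s : ℕ} {w : Fin s → (Fin d₀ → ℂ) × (Fin d₁ → ℂ)} {g : Fin s → MvPolynomial (Fin d₀ ⊕ Fin d₁) ℂ}
  {𝔭 𝔮 : Ideal (MvPolynomial (Fin d₀ ⊕ Fin d₁) ℂ)}

/-- **Step 3** (Roy, Prop. 3.8): let `K` be a finite set of multi-indices of order `≤ T` and
`(F_l)` a finite family linearly independent modulo the prime `𝔭`. If a `ℂ`-combination
`∑ c_{l,κ} F_l g^κ` lies in `𝔮` then all `c_{l,κ}`, `κ ∈ K`, vanish.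
[cite: NesterenkoPhilippon2001, Ch. 11 Prop. 3.8 (Step 3)] -/
theorem coeff_eq_zero_of_sum_mem (h𝔭 : 𝔭.IsPrime) (hg : ∀ i, g i ∈ 𝔭)
    (hoff : ∀ i j, i ≠ j → invDeriv (w i) (g j) ∈ 𝔭) (hdiag : ∀ i, invDeriv (w i) (g i) ∉ 𝔭)
    {T : ℕ} (H𝔮 : ∀ f ∈ 𝔮, ∀ μ : Fin s → ℕ, order μ ≤ T → opPow w μ f ∈ 𝔭)
    (K : Finset (Fin s → ℕ)) (hK : ∀ κ ∈ K, order κ ≤ T)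
    {ι : Type*} [Fintype ι] {F : ι → MvPolynomial (Fin d₀ ⊕ Fin d₁) ℂ}
    (hF : ∀ c : ι → ℂ, (∑ l, c l • F l) ∈ 𝔭 → ∀ l, c l = 0)
    (c : ι → (Fin s → ℕ) → ℂ) (hc : (∑ l, ∑ κ ∈ K, c l κ • (F l * gpow g κ)) ∈ 𝔮) :
    ∀ l, ∀ κ ∈ K, c l κ = 0 := by
  classical
  -- bottom-up in the order
  suffices H : ∀ m, ∀ l, ∀ κ ∈ K, order κ < m → c l κ = 0 from
    fun l κ hκ => H (order κ + 1) l κ hκ (Nat.lt_succ_self _)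
  intro m
  induction m with
  | zero => intro l κ _ h; exact absurd h (Nat.not_lt_zero _)
  | succ m ih =>
    intro l₀ μ hμK hμm
    rcases Nat.lt_or_ge (order μ) m with hlt | hge
    · exact ih l₀ μ hμK hlt
    have hμ : order μ = m := by omega
    -- apply `D^μ` to the relation
    have h1 : opPow w μ (∑ l, ∑ κ ∈ K, c l κ • (F l * gpow g κ)) ∈ 𝔭 := H𝔮 _ hc μ (hμ ▸ hK μ hμK |> fun h => by omega)
    set r : ι → (Fin s → ℕ) → MvPolynomial (Fin d₀ ⊕ Fin d₁) ℂ := fun l κ =>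
      opPow w μ (F l * gpow g κ) - (if κ = μ then lemmaBUnit w g μ * F l else 0) with hr
    have hexp : opPow w μ (∑ l, ∑ κ ∈ K, c l κ • (F l * gpow g κ)) =
        lemmaBUnit w g μ * (∑ l, c l μ • F l) + ∑ l, ∑ κ ∈ K, c l κ • r l κ := by
      rw [opPow_sum]
      simp_rw [opPow_sum, opPow_smul]
      have hterm : ∀ l κ, c l κ • opPow w μ (F l * gpow g κ) =
          c l κ • (if κ = μ then lemmaBUnit w g μ * F l else 0) + c l κ • r l κ := by
        intro l κ; rw [hr]; simp only; rw [← smul_add, add_sub_cancel]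
      simp_rw [hterm, Finset.sum_add_distrib]
      congr 1
      rw [Finset.mul_sum]
      refine Finset.sum_congr rfl fun l _ => ?_
      have hite : ∀ κ ∈ K, c l κ • (if κ = μ then lemmaBUnit w g μ * F l else 0) =
          if κ = μ then c l μ • (lemmaBUnit w g μ * F l) else 0 := fun κ _ => by
        split_ifs with h <;> simp [h]
      rw [Finset.sum_congr rfl hite, Finset.sum_ite_eq', if_pos hμK, mul_smul_comm]
    -- the `r`-part lies in `𝔭`
    have h2 : (∑ l, ∑ κ ∈ K, c l κ • r l κ) ∈ 𝔭 := by
      refine Ideal.sum_mem _ fun l _ => Ideal.sum_mem _ fun κ hκ => ?_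
      rcases Nat.lt_or_ge (order κ) m with hlt | hge'
      · rw [ih l κ hκ hlt, zero_smul]; exact Ideal.zero_mem _
      · rw [smul_eq_C_mul]
        exact Ideal.mul_mem_left _ _ (opPow_mul_gpow_sub_mem hg hoff m μ hμ (F l) κ hge')
    rw [hexp] at h1
    have h3 : lemmaBUnit w g μ * (∑ l, c l μ • F l) ∈ 𝔭 := by
      have := Ideal.sub_mem _ h1 h2
      rwa [add_sub_cancel_right] at this
    rcases h𝔭.mem_or_mem h3 with h4 | h4
    · exact absurd h4 (lemmaBUnit_notMem w h𝔭 hdiag μ)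
    · exact hF (fun l => c l μ) h4 l₀

end Step3

/-! ### The count for the box filtration -/

section Count

variable {D₀ D₁ : ℕ}

/-- Powers of box polynomials. [folklore] -/
theorem pow_mem_Box {c : ℕ} {P : MvPolynomial (Fin d₀ ⊕ Fin d₁) ℂ} (hP : P ∈ Box (d₀ := d₀) (d₁ := d₁) D₀ D₁ c) (k : ℕ) :
    P ^ k ∈ Box (d₀ := d₀) (d₁ := d₁) D₀ D₁ (c * k) := by
  induction k with
  | zero => simpa using one_mem_Box (d₀ := d₀) (d₁ := d₁) D₀ D₁ 0
  | succ k ih => rw [pow_succ, Nat.mul_succ]; exact mul_mem_Box ih hP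

/-- Power products of box polynomials: `g^κ ∈ Box(c|κ|)`. [folklore] -/
theorem gpow_mem_Box {s c : ℕ} {g : Fin s → MvPolynomial (Fin d₀ ⊕ Fin d₁) ℂ} (hg : ∀ i, g i ∈ Box (d₀ := d₀) (d₁ := d₁) D₀ D₁ c)
    (κ : Fin s → ℕ) : gpow g κ ∈ Box (d₀ := d₀) (d₁ := d₁) D₀ D₁ (c * order κ) := by
  classical
  unfold gpow order
  have key : ∀ t : Finset (Fin s), ∏ i ∈ t, g i ^ κ i ∈ Box (d₀ := d₀) (d₁ := d₁) D₀ D₁ (c * ∑ i ∈ t, κ i) := by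
    intro t
    induction t using Finset.induction_on with
    | empty => simpa using one_mem_Box (d₀ := d₀) (d₁ := d₁) D₀ D₁ 0
    | insert a t ha ih =>
      rw [Finset.prod_insert ha, Finset.sum_insert ha, Nat.mul_add]
      exact mul_mem_Box (pow_mem_Box (hg a) _) ih
  exact key Finset.univ

variable {s : ℕ} {w : Fin s → (Fin d₀ → ℂ) × (Fin d₁ → ℂ)} {g : Fin s → MvPolynomial (Fin d₀ ⊕ Fin d₁) ℂ}
  {𝔭 𝔮 : Ideal (MvPolynomial (Fin d₀ ⊕ Fin d₁) ℂ)}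

/-- **The count** (Roy (95)): `binom(T+s, s) · H_𝔭(t) ≤ H_𝔮(t + cT)` for the box filtration, with
`H_N(t) = dim Box(t) - dim(Box(t) ∩ N)` (`LinGroup.hilbI`). [cite: NesterenkoPhilippon2001, Ch. 11 Prop. 3.8 (95)] -/
theorem choose_mul_hilbI_le (h𝔭 : 𝔭.IsPrime) (hg : ∀ i, g i ∈ 𝔭)
    (hoff : ∀ i j, i ≠ j → invDeriv (w i) (g j) ∈ 𝔭) (hdiag : ∀ i, invDeriv (w i) (g i) ∉ 𝔭)
    {T : ℕ} (H𝔮 : ∀ f ∈ 𝔮, ∀ μ : Fin s → ℕ, order μ ≤ T → opPow w μ f ∈ 𝔭)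
    {c : ℕ} (hgBox : ∀ i, g i ∈ Box (d₀ := d₀) (d₁ := d₁) D₀ D₁ c) (t : ℕ) :
    (T + s).choose s * hilbI (d₀ := d₀) (d₁ := d₁) D₀ D₁ (Submodule.restrictScalars ℂ 𝔭) t ≤
      hilbI (d₀ := d₀) (d₁ := d₁) D₀ D₁ (Submodule.restrictScalars ℂ 𝔮) (t + c * T) := by
  classical
  -- a basis of `Box(t)` modulo `Box(t) ∩ 𝔭`
  set V : Submodule ℂ (MvPolynomial (Fin d₀ ⊕ Fin d₁) ℂ) := Box (d₀ := d₀) (d₁ := d₁) D₀ D₁ t with hV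
  set U : Submodule ℂ ↥V := (Submodule.restrictScalars ℂ 𝔭).comap V.subtype with hU
  set b := Module.finBasis ℂ (↥V ⧸ U) with hb
  set N := finrank ℂ (↥V ⧸ U) with hN
  have hNeq : N = hilbI (d₀ := d₀) (d₁ := d₁) D₀ D₁ (Submodule.restrictScalars ℂ 𝔭) t := by
    have h1 := Submodule.finrank_quotient_add_finrank U
    have hmap : U.map V.subtype = V ⊓ Submodule.restrictScalars ℂ 𝔭 := by
      ext x
      simp only [Submodule.mem_map, Submodule.mem_comap, Submodule.coe_subtype, hU,
        Submodule.mem_inf, Submodule.restrictScalars_mem]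
      constructor
      · rintro ⟨y, hy, rfl⟩; exact ⟨y.2, hy⟩
      · rintro ⟨hx, hx'⟩; exact ⟨⟨x, hx⟩, hx', rfl⟩
    have h2 : finrank ℂ U = finrank ℂ ↥(V ⊓ Submodule.restrictScalars ℂ 𝔭) := by
      rw [← Submodule.finrank_map_subtype_eq V U, hmap]
    rw [hilbI, ← h1, h2, Nat.add_sub_cancel]
  -- lifts of the basis vectors
  choose F hF using fun l => Submodule.Quotient.mk_surjective U (b l)
  have hFind : ∀ d : Fin N → ℂ, (∑ l, d l • (F l : MvPolynomial (Fin d₀ ⊕ Fin d₁) ℂ)) ∈ 𝔭 →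
      ∀ l, d l = 0 := by
    intro d hd
    have hmem : (∑ l, d l • F l : ↥V) ∈ U := by
      simp only [hU, Submodule.mem_comap, Submodule.coe_subtype, Submodule.restrictScalars_mem,
        Submodule.coe_sum, Submodule.coe_smul]
      exact hd
    have h0 : (∑ l, d l • b l : ↥V ⧸ U) = 0 := by
      have h := (Submodule.Quotient.mk_eq_zero U).mpr hmem
      rw [← Submodule.mkQ_apply, map_sum] at h
      simp_rw [map_smul, Submodule.mkQ_apply, hF] at h
      exact h
    exact fun l => Fintype.linearIndependent_iff.mp b.linearIndependent d h0 l
  -- the family `Φ (l, κ) = F_l g^κ`, `κ ∈ K = indexSet s T`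
  set K := indexSet s T with hK
  set Φ : Fin N × ↥K → MvPolynomial (Fin d₀ ⊕ Fin d₁) ℂ := fun p => (F p.1 : MvPolynomial (Fin d₀ ⊕ Fin d₁) ℂ) *
    gpow g p.2.1 with hΦ
  have hΦmem : ∀ p, Φ p ∈ Box (d₀ := d₀) (d₁ := d₁) D₀ D₁ (t + c * T) := fun p =>
    Box_mono (by have := order_le_of_mem_indexSet p.2.2; nlinarith) (mul_mem_Box (F p.1).2
      (gpow_mem_Box hgBox p.2.1))
  have hcoef : ∀ d : Fin N × ↥K → ℂ, (∑ p, d p • Φ p) ∈ 𝔮 → ∀ p, d p = 0 := by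
    intro d hd p
    have key := coeff_eq_zero_of_sum_mem h𝔭 hg hoff hdiag H𝔮 K (fun κ hκ => order_le_of_mem_indexSet hκ)
      hFind (fun l κ => if h : κ ∈ K then d (l, ⟨κ, h⟩) else 0) ?_ p.1 p.2.1 p.2.2
    · simpa using key
    · have e : (∑ l, ∑ κ ∈ K, (if h : κ ∈ K then d (l, ⟨κ, h⟩) else 0) •
          ((F l : MvPolynomial (Fin d₀ ⊕ Fin d₁) ℂ) * gpow g κ)) = ∑ p, d p • Φ p := by
        rw [Fintype.sum_prod_type]
        refine Finset.sum_congr rfl fun l _ => ?_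
        rw [← Finset.sum_coe_sort K]
        refine Finset.sum_congr rfl fun κ _ => ?_
        rw [dif_pos κ.2]
      rw [e]; exact hd
  have hli : LinearIndependent ℂ Φ :=
    Fintype.linearIndependent_iff.mpr fun d hd => hcoef d (by rw [hd]; exact Ideal.zero_mem _)
  set S := Submodule.span ℂ (Set.range Φ) with hS
  set Q := Box (d₀ := d₀) (d₁ := d₁) D₀ D₁ (t + c * T) ⊓ Submodule.restrictScalars ℂ 𝔮 with hQ
  have hdisj : S ⊓ Q = ⊥ := by
    rw [Submodule.eq_bot_iff]
    rintro x ⟨hx, hx'⟩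
    obtain ⟨d, rfl⟩ := (Submodule.mem_span_range_iff_exists_fun ℂ).mp hx
    have h0 := hcoef d hx'.2
    simp [h0]
  have hle : S ⊔ Q ≤ Box (d₀ := d₀) (d₁ := d₁) D₀ D₁ (t + c * T) :=
    sup_le (Submodule.span_le.mpr (by rintro _ ⟨p, rfl⟩; exact hΦmem p)) inf_le_left
  have hfinS : finrank ℂ S = N * K.card := by
    rw [hS, finrank_span_eq_card hli, Fintype.card_prod, Fintype.card_fin, Fintype.card_coe]
  haveI : FiniteDimensional ℂ S := FiniteDimensional.span_of_finite ℂ (Set.finite_range Φ)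
  haveI : FiniteDimensional ℂ Q := Submodule.finiteDimensional_of_le (inf_le_left :
    Q ≤ Box (d₀ := d₀) (d₁ := d₁) D₀ D₁ (t + c * T))
  have hsum := Submodule.finrank_sup_add_finrank_inf_eq S Q
  rw [hdisj, finrank_bot, add_zero] at hsum
  have hmono := Submodule.finrank_mono hle
  rw [card_indexSet] at hfinS
  set P := (T + s).choose s * N with hP
  have hfinS' : finrank ℂ S = P := by rw [hfinS, hP, mul_comm]
  have hQle : finrank ℂ Q ≤ finrank ℂ ↥(Box (d₀ := d₀) (d₁ := d₁) D₀ D₁ (t + c * T)) := Submodule.finrank_mono inf_le_left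
  rw [← hNeq]
  show P ≤ finrank ℂ ↥(Box (d₀ := d₀) (d₁ := d₁) D₀ D₁ (t + c * T)) - finrank ℂ Q
  omega

end Count

end LinGroup

end Literature.NumberTheory.Transcendental
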